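import Mathlib
import HarnessLib
import HarnessLib.Audit
import Summits.AtomisticToContinuum.Statement
import Literature.MathematicalPhysics.StatisticalMechanics.LennardJonesClusters
import Literature.MathematicalPhysics.StatisticalMechanics.HaggStacking
import Literature.MathematicalPhysics.StatisticalMechanics.BarlowStacking
import Literature.MathematicalPhysics.StatisticalMechanics.BarlowStackingEnergy
import Summits.AtomisticToContinuum.Crystallization.Theorems.ExcessDecayLiouvilleCrysEnergyLimit
import HarnessLib.Audit.Status.Attr

/-!
Route: MinMeanCycleStackingLock

DORMANT since 2026-08-22T11:54:39Z (reconciler: no traction for 5.3 d (last activity item-evidence-added at 2026-08-17T03:48:42Z); parked, not closed — `ledger route dormant route-AtomisticToContinuum-MinMeanCycleStackingLock --off` to ) — unstaffed, not closed; items shared with open routes are served there. `ledger route dormant <id> --off` reactivates.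

# Route MinMeanCycleStackingLock — stacking selection as a locked phase — min-mean-cycle dual
certificate + Peierls tail stability, with a polytype-agnostic positional hinge

X = X_lock ∧ X_red ∧ X_pos ("it suffices to show"), realising card karp-peierls-stacking-lock; this
is the CONFORMING gen-2 re-filing
(D-0027 §2.1) of route-AtomisticToContinuum-KarpPeierlsStackingLock (retired 2026-08-15T13:43Z
`not-a-thesis` only because its assembly named
the Literature constant instead of the sub-problem decl), with the positional conjunct re-sourced.
X_lock = LockedStackingOnBox (target): for
every (a,h) in the relaxation box B = {47/50 ≤ a ≤ 1, 39/50·a ≤ h ≤ 17/20·a} (shared with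
PoissonBesselStacking; contains the relaxed LJ hcp
point a* ≈ 0.9712, h* ≈ 0.793) the Lennard-Jones registry couplings J_k(a,h) = barlowCoupling
lennardJones a h k have Σ k|J_k| < ∞ and the
stacking energy density haggStackingEnergy J over ALL Hägg sequences is minimised by a PERIODIC one
— reached as PeierlsKarpStability (a finite
min-mean-cycle dual certificate at window K with node potentials u, value λ and Peierls gap g ≥
2Σ_{k>K}(k+|E|+1)|J_k| forces a periodic
minimiser of the infinite-range chain) + LJLockingCertificate (such a certificate exists for LJ
uniformly on B; expected witness K = 2,
E = {+−,−+}, u ≡ 0: Hägg domination) via the glue CertificateLocks. X_red =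
PeriodicReductionToBarlow (shared 3062): every periodic
configuration of ℝ³ is energetically matched by a uniform Barlow stacking with parameters in B.
X_pos = BulkDefectVanishBased (NEW, the
base-point form of hinge 0751 proposed by refuter g28-4): ONE periodic P such that all but o(N)
particles of every LJ ground state see, in
every R-window, an isometric copy of P.points − p for some p ∈ P.points — no vertex-transitivity is
presumed, so the hinge stays true for
whichever polytype the certificate locks (hcp, dhcp, 9R …). Given X: LockedBoxMinimiser (compactness
of B + layer bookkeeping) yields the
attained periodic minimum, CrysEnergyLimit (0626) the limit E(N)/N → ⨅,
BasedDefectVanishCrystallizes + the PROVED fact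
LennardJonesMinimalDistance the positional conjunct.
Lean: `LockedStackingOnBox ∧ PeriodicReductionToBarlow ∧ BulkDefectVanishBased`

## Assembly
Pure logic plus IsLeast.csInf_eq and the PROVED Literature theorem LennardJonesMinimalDistance_holds
— sorry-free in the planner's Sketch.lean
(`assembly_provable` and the deciding theorem `closes`, axioms propext / Classical.choice /
Quot.sound, lean check rc 0): CertificateLocks
applied to PeierlsKarpStability and LJLockingCertificate gives the target; LockedBoxMinimiser turns
target + PeriodicReductionToBarlow +
BarlowEnergyIdentification + HaggEnergyPeriodic into an attained periodic minimum P (0627); ⨅_Q e(Q)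
= e(P) by IsLeast.csInf_eq, so
CrysEnergyLimit is the Tendsto clause of HasPeriodicGroundStateEnergy; BasedDefectVanishCrystallizes
applied to BulkDefectVanishBased and the
minimal-distance fact is IsCrystallizing; the pair is `_root_.Crystallization` (the sub-problem
decl, an abbrev of the Literature statement).
The deciding theorem `closes` takes all 13 items as hypotheses (LockedPhaseDefectBound and Assembly
are carried, not used) and concludes
`_root_.Crystallization`.

Rationale: WHY THIS LINE. Stacking selection for Lennard-Jones is a zero-temperature ERGODIC OPTIMISATION
problem on the 3-letter Hägg shift with summable registry
couplings; at finite range K its minimisers are minimum mean cycles of a de Bruijn graph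
(Teubner1990, RadinSchulman1983) and LP/Bellman
duality hands out node potentials turning the truncated interaction into an equivalent m-potential
with a Peierls constant
(HolsztynskiSlawny1978; FriedliVelenik2017 Lemma 7.13) — a calibrated sub-action in the sense of
Contreras2015 / Garibaldi's ergodic
optimisation. The step not found in print is the TAIL-STABILITY LEMMA: the gap survives the
infinite-range remainder when
g ≥ 2Σ_{k>K}(k+|E|+1)|J_k|, which makes "is the LJ stacking periodic?" a terminating finite
certificate whenever LJ sits in the interior of a
locking plateau — the generic situation for couplings decaying faster than k⁻³
(GlodkowskiMiekisz2024, VanenterKoivusaloMiekisz2019).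
Imported areas: ergodic optimisation / symbolic dynamics (min-mean-cycle, sub-actions),
Pirogov–Sinai ground-state theory (m-potentials,
Peierls condition), certified computation (interval lattice sums). What it does that the open
sibling routes do not: PoissonBesselStacking
bets on the single hand inequality |J₂| ≥ 2Σ(k−1)|J_k| (K = 2) and LuttingerTiszaRegistry on a
period-2 Fourier/Toeplitz certificate — both
are hcp-specific and feed the vertex-transitive hinge 0751; this line certifies ANY winning polytype
(K = 3, 4 lock 4H/6H/9R if the J₂
numerics were ever overturned), supplies the quantitative fault price for every K
(LockedPhaseDefectBound), and pairs it with the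
base-point hinge that does not presuppose which polytype wins. Negatives index (6 refuted, 2 in this
sub-problem: 4146, 3506) touches no
Hägg-chain statement.

RANKED CRUXES. #0 LockedStackingOnBox (target) — X_lock — for all (a,h) ∈ B: Σ_k k|J_k(a,h)| < ∞ for
J = barlowCoupling lennardJones a h, and some periodic Hägg sequence w minimises haggStackingEnergy
J over all Hägg sequences (= PeierlsKarpStability + LJLockingCertificate via CertificateLocks;
identical signature to retired item 3452). (why it might fail: False iff at some (a,h) ∈ B the LJ
registry chain has no periodic minimiser (Sturmian/aperiodic selection): for couplings decaying
faster than k⁻³ that needs a codimension-≥1 coincidence, but the J_k are uncertified on B.)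
[GlodkowskiMiekisz2024, VanenterKoivusaloMiekisz2019, PartayOrtnerCsanyi2017, LoachAckland2017,
stmt-AtomisticToContinuum-3452]
#2 PeriodicReductionToBarlow (crux) — X_red (shared item 3062 of PoissonBesselStacking /
LuttingerTiszaRegistry, identical signature): for every periodic configuration Q of ℝ³ (any
full-rank lattice, any finite motif) there are (a,h) ∈ B and a p-periodic Hägg sequence s such that
the UNIFORM Barlow stacking barlowPeriodicConfiguration s at (a,h) has LJ energy per particle ≤ that
of Q. The genuinely 3-D content (local optimality of close packing); this route consumes it and
files no children for it. [difficulty: open-problem] (why it might fail: Contains local optimality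
of close packing among ALL lattice+motif configurations (open, BlancLewin2015 §2.3); uniform
spacings must beat layer-wise relaxed polytypes (gain ≲1e−8 vs hcp margin 3.6e−5 per layer,
uncertified); the optimum might leave B.) [BlancLewin2015, FlatleyTheil2015,
BeterminSamajTravenec2022, Stillinger2001, PartayOrtnerCsanyi2017, stmt-AtomisticToContinuum-3062]
#3 PeierlsKarpStability (crux) — PEIERLS–KARP STABILITY LEMMA (card S1; pure 1-D lattice-gas theorem
over HaggStacking.lean, no LJ input; identical signature to retired item 3454, refuter-verified TRUE
on paper there): for couplings J with Σ k|J_k| < ∞, a window length K = L+1, a nonempty set E of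
Hägg K-words with out-degree ≤ 1, in-degree ≤ 1 and continuation inside E (E = disjoint simple
cycles of the de Bruijn graph), potentials u on (K−1)-words, value λ and gap g such that the slack
Σ_{k=2}^{K} J_k·1[x₀+…+x_{k−1} ≡ 0 (3)] − λ + u(prefix x) − u(suffix x) vanishes on E and is ≥ g on
every other Hägg K-word, and g ≥ 2Σ_{k>K}(k+|E|+1)|J_k|: SOME periodic sequence all of whose
K-windows lie in E minimises haggStackingEnergy J over all Hägg sequences. K = 2, E = {+−,−+}, u ≡ 0
is Hägg domination (0737) with a cruder constant. [difficulty: M] (why it might fail: Only by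
bookkeeping: the tail constant 2Σ_{k>K}(k+|E|+1)|J_k|, windows poking beyond n, liminf junk values
or a missing structural clause on E; the refuter paper proof on 3454 and brute force at K ≤ 3
(periods ≤ 10) found no violation.) [RadinSchulman1983, Teubner1990, HolsztynskiSlawny1978,
FriedliVelenik2017, Contreras2015, GlodkowskiMiekisz2024, stmt-AtomisticToContinuum-3454,
stmt-AtomisticToContinuum-0737]
#4 LJLockingCertificate (crux) — CERTIFIED LOCKING CERTIFICATE for Lennard-Jones on the box (card
S2–S3; identical signature to retired item 3453): there are a window length K = L+1 and a set E of
Hägg K-words forming node-disjoint simple cycles such that for every (a,h) ∈ B, with J =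
barlowCoupling lennardJones a h: Σ k|J_k| < ∞ and there are node potentials u, a value λ and a gap g
with slack = 0 on E, ≥ g on every other Hägg K-word, and g ≥ 2Σ_{k>K}(k+|E|+1)|J_k|. Expected
witness: L = 1, E = {(+,−),(−,+)}, u ≡ 0, λ = J₂ < 0, g = −J₂ ≈ 7e−5 against 2Σ_{k≥3}(k+3)|J_k| ∈
[3.8e−7, 3.0e−6] on B (float ratio 47–98); to be certified by interval arithmetic (direct layer sums
with an r⁻⁶ tail bound, or the Poisson–Bessel form of PoissonBesselStacking) uniformly on B — one
interval job shared with item 3063. [deps: PeierlsKarpStability] [difficulty: L] (why it might fail: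
Needs interval-certified 2-D lattice sums J_k(a,h) uniformly on B plus a tail bound (no such
infrastructure in tree); fails if J₂ changes sign on B or no finite K locks (Hubbard-type
selection); the K=2 witness rests on uncertified floats (ratio 47–98).) [PartayOrtnerCsanyi2017,
LoachAckland2017, Stillinger2001, stmt-AtomisticToContinuum-3063, stmt-AtomisticToContinuum-3453,
Literature.Barriers.AtomisticToContinuum.Hubbard1978_mostHomogeneous]
#5 BulkDefectVanishBased (crux) — X_pos, the POLYTYPE-AGNOSTIC HINGE (new; the base-point variant of
0751 suggested by refuter g28-4, 2026-08-13): there is ONE periodic configuration P such that for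
every window radius R and tolerance ε, in every sequence of LJ ground states all but o(N) particles
i admit a linear isometry A and a base point p ∈ P.points with the particles of B_R(x_i) ε-matched
both ways to x_i + A((P.points − p) ∩ B_R). Unlike 0751 (pattern x_i + A(P.points), which silently
forces 0 ∈ P.points and a VERTEX-TRANSITIVE limit crystal — true for hcp/fcc, false for dhcp-type
polytypes) it holds for whichever Barlow polytype the certificate locks; 0751 implies it (p = 0).
Its stacking half is fed by this route's fault price (LockedPhaseDefectBound ⇒ ≤ (Δ + C)/(g −
2·tail) off-certificate windows against the O(N^{2/3}) surface budget ⇒ O(1) fault planes); its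
layering half (soft twelve-coordination + a local Hales step) is the shared open physics of every
sphere-packing-heritage route. [difficulty: XL] (why it might fail: Needs layering of finite LJ
ground states (soft twelve-coordination + a local-Hales step whose 1%-tolerance form is refuted,
negatives 4146; Böröczky–Szabó quasi-12-shells) plus O(1) fault planes; persistent
icosahedral/polytetrahedral bulk order in LJ ground states refutes it.) [BlancLewin2015,
FlatleyTheil2015, Hales2012, LucaFriesecke2016, BoroczkySzabo2016, PartayOrtnerCsanyi2017,
stmt-AtomisticToContinuum-0751, stmt-AtomisticToContinuum-4146]
#9 CertificateLocks (support) — glue of the target: the stability lemma instantiated with the LJ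
certificate gives LockedStackingOnBox (pure instantiation; E-words are Hägg words, so the E-periodic
minimiser is a Hägg sequence). Identical signature shape to retired 3455, which a refuter PROVED as
evidence (CertEvidence on 3455) — re-prove against the new decls. [difficulty: provable-now]
[RadinSchulman1983, stmt-AtomisticToContinuum-3455]
#9 BarlowEnergyIdentification (support) — layer bookkeeping (shared item 3065, identical signature;
the identification left open in BarlowStackingEnergy.lean): for a, h > 0 and a p-periodic Hägg
sequence s, the energy per particle of barlowPeriodicConfiguration s for Lennard-Jones equals
barlowBaseEnergy lennardJones a h + haggEnergy p (barlowCoupling lennardJones a h) s / p (regroup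
the absolutely convergent point-set sum by layers: barlowPeriodicConfiguration_points,
barlowSiteEnergy_average_eq_haggEnergy, summability from le_dist_barlowPos and the r⁻⁶ tail).
[difficulty: M] [BlancLewin2015, PartayOrtnerCsanyi2017, stmt-AtomisticToContinuum-3065]
#9 HaggEnergyPeriodic (support) — for summable J and a p-periodic sequence s (p > 0) the stacking
energy density haggStackingEnergy J s (a liminf of H_n/n) equals the per-period average haggEnergy p
J s / p (local energies are p-periodic in the base point, H_{qp+r} = q·H_p + O(p·Σ|J_k|);
haggLocalEnergy_periodic, liminf of a convergent sequence). Identical signature to retired 3456;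
useful to every stacking route. [difficulty: provable-now] [PartayOrtnerCsanyi2017,
stmt-AtomisticToContinuum-3456]
#9 CrysEnergyLimit (support) — energetic thermodynamic limit (shared item 0626, identical
signature): E(N)/N → ⨅ over periodic configurations of the LJ energy per particle (periodisation
0715 + trial blocks 0629 + stability 0713; bookkeeping owned jointly with every route of the
sub-problem, not this route's content). [difficulty: L] [BlancLewin2015,
stmt-AtomisticToContinuum-0626]
#9 LockedBoxMinimiser (support) — ANALYSIS GLUE to the attained periodic minimum (0627; = retired
3457 with the third hypothesis written out): LockedStackingOnBox → PeriodicReductionToBarlow → [the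
statement of BarlowEnergyIdentification, item 3065, INLINED verbatim — the gate renders rank-9 items
in id-string order, so this new item must not name a decl whose 4-digit id sorts after its own
5-digit one; `closes` feeds the item BarlowEnergyIdentification into this slot by definitional
unfolding] → HaggEnergyPeriodic → ∃ P periodic, IsLeast (range e_LJ) (e P). Proof: φ(a,h) := e₀(a,h)
+ min_s haggStackingEnergy(J(a,h), s) is continuous on the compact box B (e₀ and (a,h) ↦
(J_k(a,h))_k ∈ ℓ¹ depend continuously on (a,h) by uniform convergence of the LJ layer sums on B; an
infimum of an equicontinuous affine family is continuous), so it is attained at some (a₀,h₀); P :=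
barlowPeriodicConfiguration w_{a₀,h₀}; for any Q the reduction gives a box stacking s_Q at (a,h)
with e(Q) ≥ e(s_Q) = e₀(a,h) + H_p/p ≥ e₀(a,h) + haggStackingEnergy(s_Q) ≥ φ(a,h) ≥ φ(a₀,h₀) = e(P).
[difficulty: M] [BlancLewin2015, BeterminSamajTravenec2022, stmt-AtomisticToContinuum-0627,
stmt-AtomisticToContinuum-3457]
#9 LockedPhaseDefectBound (support) — QUANTITATIVE LOCKING (the Peierls inequality behind the lemma,
supplier of the per-fault price that the stacking half of the hinge consumes; identical signature to
retired 3458, refuter-verified TRUE on paper with C = osc(u) + t₁ + |E|t₀/2): under the hypotheses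
of PeierlsKarpStability there are an E-periodic w and a constant C such that for every Hägg sequence
s and every n: (g − 2Σ_{k>K}(k+|E|+1)|J_k|)·#{m < n : the K-window of s at m is not in E} ≤
haggEnergy n J s − n·haggStackingEnergy J w + C. [difficulty: M] [HolsztynskiSlawny1978,
FriedliVelenik2017, stmt-AtomisticToContinuum-3458, stmt-AtomisticToContinuum-0759]
#9 BasedDefectVanishCrystallizes (support) — SOFT ASSEMBLY LEMMA for the based hinge (the analogue
of 0752): BulkDefectVanishBased together with the uniform minimal distance of LJ ground states
implies IsCrystallizing lennardJones 3 — pick R_k = k, ε_k = 1/k, indices N_k ↑, good particles i_k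
with isometries A_k and base points p_k; reduce p_k modulo P.lattice to the finite motif (P.points −
p depends only on p mod lattice) and pass to a subsequence with constant motif point y; τ_k :=
−x_{i_k}; extract A_k → A in O(3); minimal distance (given) + discreteness of P (forced by the ∀ε
matching) make the ε-matching a local bijection, so Σ_i f(x_i + τ_k) → Σ_{s ∈ A(P.points − y)} f(s)
for f ∈ C_c; A(P − y) is again a PeriodicConfiguration, multiplicity m ≡ 1. [difficulty: M]
[BlancLewin2015, Xue1997, stmt-AtomisticToContinuum-0752]

TWO-LAYER PLAN. LockedStackingOnBox ⇐ PeierlsKarpStability → LJLockingCertificate →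
LockedStackingOnBox (glue CertificateLocks, filed as support now).
Foreseen once LJLockingCertificate moves: LJLockingCertificate ⇐ CertifiedCouplingBox (interval
enclosures of J₂…J_K on B, shared with 3063's
interval job) → RegistryTailBound (Σ_{k>K}(k+|E|+1) sup_B |J_k| ≤ explicit, from the r⁻⁶ layer tail
or the Bessel form 3068) → LJLockingCertificate
(the 2^K slack checks are `decide`/`norm_num`). Foreseen for the hinge: BulkDefectVanishBased ⇐
GroundStateLayering (all but o(N) particles sit in
soft triangular layers stacked at hole registry — the shared layering physics; local Hales only at
tolerance ≤ 1/400 per BrittleRungDescent, never the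
refuted 1/100) → StackingFaultCount (LockedPhaseDefectBound + surface budget ⇒ ≤ C·N^{2/3}/(g −
2·tail) off-certificate windows, hence O(1) fault planes
per ground state) → BulkDefectVanishBased. ALTERNATIVE decomposition of PeriodicReductionToBarlow
kept in reserve (this mechanism's native move, to be
filed only if PoissonBesselStacking's analytic hole-locking/uniformisation children stall): run the
SAME min-mean-cycle certificate on the 4-letter
de Bruijn graph {A, B, C, off-hole} with window weights = certified infima over the window's
continuous offsets/spacings (interval branch-and-bound),
so that hole locking and spacing uniformisation become part of one finite certificate and the 3-D
crux shrinks to layering alone; needs a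
LayeredStacking object (definition request at split time, not now).

KILL CRITERIA. LJLockingCertificate refuted on B for EVERY K (a certified evaluation with J₂ ≥ 0
somewhere on B and no K = 3, 4 lock, or a proof that the LJ
registry chain has a non-periodic unique ground state) closes the route
`refuted:LJLockingCertificate` and hands the witness to a refutation
route (¬ conjunct (i) via aperiodic selection). PeierlsKarpStability refuted = a
constant/bookkeeping error (class misstated): add the repaired
lemma as a new item and re-certify `closes`; no pivot. PeriodicReductionToBarlow refuted because the
optimum leaves B or needs layer-wise
spacings: restate jointly with PoissonBesselStacking on the corrected box / a layer-relaxed family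
(pivot, same line; the reserve decomposition
above); refuted because a non-close-packed periodic structure wins: every stacking-selection route
is moot — close. BulkDefectVanishBased refuted
(persistent non-crystalline bulk order in LJ ground states) kills conjunct (ii) for every
sphere-packing-heritage route; this route cannot shrink
to conjunct (i) (the Statement is the conjunction) — close `refuted:BulkDefectVanishBased`. 0627
proved elsewhere (PoissonBessel / LuttingerTisza
energetic halves) moots X_lock ∧ X_red; the route then lives through LockedPhaseDefectBound (fault
price for every K) and the based hinge.

NOT DECOMPOSED YET. The interval-arithmetic format of the coupling box and the tail bound (children
of LJLockingCertificate); the (a,h)-dependence of the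
potentials u (pointwise in the statement, uniform in practice); layer-wise relaxation and in-plane
distortion (children of
PeriodicReductionToBarlow, owned by PoissonBesselStacking — or the reserve certificate decomposition
above); the uniform-convergence lemmas
inside LockedBoxMinimiser; the layering of finite ground states and the fault-plane count inside the
hinge (shared physics, see Two-layer
plan); uniqueness / zero defect density of minimising sequences (a corollary of
LockedPhaseDefectBound, not needed for the Statement);
mirror/negation symmetry of optimal cycles (handled inside the lemma by allowing several E-cycles);
nothing below layer 2 is filed.

CHEAPEST FALSIFIER. (1) Brute force the typed PeierlsKarpStability / LockedPhaseDefectBound at K ≤ 3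
(random J, tails at threshold, periodic competitors of period
≤ 12, random words): done by gen-1 (hcp K = 2, dhcp/fcc locks K = 3: 0 violations), superseded by
the refuter paper proof on 3454
(g ≥ t₁ + (2+|E|/2)t₀ suffices; the typed constant has room). (2) Floats of J₂, J₃, J₄ at the
corners of B (gen-1 direct sums; PoissonBessel
refuters by Bessel series vs direct sums to 4.6e−10): J₂ ∈ [−1.44e−4, −3.68e−5] < 0, J₃ ∈ [−2.5e−7,
−3.1e−8], J₄ ∈ [−4.4e−10, −3.8e−11];
threshold 2Σ_{k≥3}(k+3)|J_k| ∈ [3.8e−7, 3.0e−6] ⇒ K = 2 witness ratio ∈ [47, 98] on B. THE killing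
job: a kit INTERVAL evaluation of the four
corners + a Lipschitz bound in (a,h) (shared with 3063) — J₂ ≥ 0 or ratio < 1 anywhere on B with no
K = 3, 4 lock kills the line. (3) New
hinge: the 0751 junk probes (over-dense P, doubled motif, sparse P) re-run by hand on the based form
— ∀ε + minimal distance exclude
doubled/over-dense P, energy excludes sparse P, p = q gives the self-match; no trivialising P.

NUMBERS. a* = (A₁₂/A₆)^{1/6} = 0.9712 (fcc: A₆ = 14.4539, A₁₂ = 12.1319; hcp: 14.4549, 12.1323;
Stillinger2001), ideal h* = a*√(2/3) = 0.7930;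
box B = {0.94 ≤ a ≤ 1, 0.78a ≤ h ≤ 0.85a} (shared with PoissonBesselStacking 3061–3068 and
LuttingerTiszaRegistry). J₁ = +0.782 (holes lock),
J₂(a*,h*) ≈ −7.26e−5, J₃ ≈ −8.5e−8, J₄ ≈ −1.1e−10 (PoissonBessel refuter numerics, evidence
numerics_route1.md on 3063; LoachAckland2017
H₂ ≈ −0.0009ε consistent); corners of B: J₂ ∈ [−1.44e−4, −3.68e−5]; Hägg-domination ratio
|J₂|/Σ_{k≥3}(k−1)|J_k| ∈ [286.9, 587] on B,
Karp K = 2 ratio with the cruder constant −J₂/(2Σ_{k≥3}(k+3)|J_k|) ∈ [47, 98]; fault price per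
off-certificate window ≥ g − 2·tail ≥ 0.97|J₂|
≥ 3.5e−5 on B; hcp below fcc by ≈ 1e−4 relative (Stillinger2001); decay |J_k| ≤ 20
e^{−(4π/√3)(h/a)k} (3068, e^{−5.9k}). Items at open: 13
(1 target, 4 cruxes — 1 shared —, 7 support — 2 shared —, 1 assembly).

DEFINITION REQUESTS. None needed to type the items: IsHaggSeq, haggEnergy, haggStackingEnergy
(HaggStacking.lean), barlowCoupling, barlowBaseEnergy
(BarlowStackingEnergy.lean), barlowPeriodicConfiguration (BarlowStacking.lean),
PeriodicConfiguration.energyPerParticle / points, lennardJones,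
IsGroundState, IsCrystallizing, groundStateEnergy (Crystallization.lean),
LennardJonesMinimalDistance (LennardJonesClusters.lean, PROVED:
LennardJonesMinimalDistance_holds) all exist (lean search --decl). The certificate predicate is
inlined; a named `IsKarpCertificate L E u lam g J`
abbreviation and, for the reserve decomposition, a `LayeredStacking` object would be requested at
split time, not now.

Novelty: Searches (2026-08-15, this session): `lit galaxy search "minimum mean cycle" --star all` (21 rows:
LNCS/OR volumes, Babenko–Karzanov
arXiv:math/0608443, Goldberg–Tarjan — Karp's problem only in combinatorial optimisation, no
lattice-gas use); `lit galaxy search "calibrated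
sub-action" --star all` (6: Garibaldi, Ergodic Optimization in the Expanding Case
(panama:257552008871963); Contreras, "Ground states are
generically a periodic orbit" (pdf); Garibaldi–Petite–Thieullen, calibrated configurations for
Frenkel–Kontorova models; Lopes–Vargas
arXiv:2105.00078 — the ergodic-optimisation side, none applied to stacking or crystallization); `lit
galaxy search "ground state stacking
sequence long-range interlayer" --star all` (0); `lit search` FTS/remote cascade unavailable this
session (searchd rc 75, noted); carried from
the gen-1 filing and its two refuter audits (same day): `lit frontier AtomisticToContinuum --since
2020` / `lit bridges --cross any` (30 + 30 rows,
none on stacking selection), `lit vsearch` min-mean-cycle / m-potential (FriedliVelenik2017 pp.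
364–366 READ: Lemma 7.13), crossref for
HolsztynskiSlawny1978 (doi:10.1007/bf01609493) and Contreras2015 (doi:10.1007/s00222-015-0638-0),
refuter-13's polytype/ANNNI sweep
(de Fontaine–Kulik 1985, Selke 1989, Bruinsma–Zangwill 1985, Cheng–Needs–Heine 1988, Loach–Ackland n
≤ 3 polytope corner, Teubner1990,
Bundaru–Angelescu–Nenciu 1973).
Nearest prior art found: Teubner1990 / RadinSchulman1983 (finite range: ground state = min  [refs: 10.1007/bf01609493, 10.1007/s00222-015-0638-0, 10.1007/s10955-024-03388-4:, math/0608443, 2105.00078, doi:10.1007/bf01609493, doi:10.1007/s00222-015-0638-0, doi:10.1007/s10955-024-03388-4, FriedliVelenik2017, HolsztynskiSlawny1978, Contreras2015, Teubner1990, RadinSchulman1983, GlodkowskiMiekisz2024]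

Barriers (technique_class: ergodic-optimisation min-mean-cycle hagg-sequence-reduction): - technique_class: ergodic-optimisation min-mean-cycle hagg-sequence-reduction
- Literature.Barriers.AtomisticToContinuum.Hubbard1978_mostHomogeneous: APPLIES in principle — it is
exactly the non-termination mode "no K certifies" (Sturmian ground states of 1-D infinite-range
chains). Evasion: Hubbard/Aubry staircases need an imposed density or chemical potential and convex
repulsive couplings of all ranges at comparable strength; the Hägg functional is unconstrained (zero
pressure, the chain picks its own letter frequencies), many-body in the spins, of unrestricted sign,
with one dominant coupling and a tail smaller by 10^{2.5}; the narrowed entry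
Hubbard1978_mostHomogeneousNarrow (evasions (a), (d)) records that the theorem is silent on this
functional and that its own lesson is LOCKING off a null parameter set — which is what the
certificate decides; non-termination is reported, never assumed away (no periodic ansatz, no period
scanning).
- Literature.Barriers.AtomisticToContinuum.ShortRangeStackingBlindness: respected — all ranges are
kept (finite K plus a rigorous tail Σ_{k>K}), the potential is never cut below √(8/3); selection
comes precisely from the r⁻⁶ registry tail beyond the second shell.
- Literature.Barriers.AtomisticToContinuum.KissingTwelveDegeneracy: evaded for selection (no
contact-graph or first-shell argument; the certificate lives on the registry chain where the
degeneracy among kissing-twelve stackings is lifted by J_k), but it APPLIES to the layering hal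

History (route lifecycle, newest last):
- 2026-08-16T03:47:38Z · AUTO-CRUX (backfill): LockedStackingOnBox — hypotheses of the deciding theorem that nothing in the route derives are cruxes (operator:999:586464)
- 2026-08-22T11:54:39Z · DORMANT — reconciler: no traction for 5.3 d (last activity item-evidence-added at 2026-08-17T03:48:42Z); parked, not closed — `ledger route dormant route-AtomisticToConti (operator:999:3922152)

sub-problem: Crystallization · status: dormant · opened planner-plancard-AtomisticToContinuum-Crystal-717b9dc8-g2-0 2026-08-15T18:47:49Z · rev 2 · ledger route-AtomisticToContinuum-MinMeanCycleStackingLock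
GENERATED by the gate from the ledger (D-0016/17). Provers cite these decls: `theorem foo : Summit.AtomisticToContinuum.Crystallization.Theses.MinMeanCycleStackingLock.<Decl> := …` in Summits/AtomisticToContinuum/Crystallization/Theorems/<Name>.lean.
-/

namespace Summit.AtomisticToContinuum.Crystallization.Theses.MinMeanCycleStackingLock

open scoped BigOperators Topology Manifold Classical MeasureTheory ProbabilityTheory Matrix InnerProductSpace ComplexConjugate ContinuousMap
open Filter Set Function TopologicalSpace MeasureTheory

attribute [summit_statement] _root_.Crystallization

/-- item stmt-AtomisticToContinuum-12017 · crux (kind.auto-crux: conjecture-grade) · rank 0 · open · by planner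
why it might fail: False iff at some (a,h) ∈ B the LJ registry chain has no periodic minimiser (Sturmian/aperiodic selection): for couplings decaying faster than k⁻³ that needs a codimension-≥1 coincidence, but the J_k are uncertified on B.
sources: GlodkowskiMiekisz2024, VanenterKoivusaloMiekisz2019, PartayOrtnerCsanyi2017, LoachAckland2017, stmt-AtomisticToContinuum-3452
[target] X_lock — for all (a,h) ∈ B: Σ_k k|J_k(a,h)| < ∞ for J = barlowCoupling lennardJones a h,
and some periodic Hägg sequence w minimises haggStackingEnergy J over all Hägg sequences (=
PeierlsKarpStability + LJLockingCertificate via CertificateLocks; identical signature to retired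
item 3452). -/
@[route_item "route-AtomisticToContinuum-MinMeanCycleStackingLock", crux]
def LockedStackingOnBox : Prop :=
  ∀ a h : ℝ, 47 / 50 ≤ a → a ≤ 1 → 39 / 50 * a ≤ h → h ≤ 17 / 20 * a → Summable (fun k : ℕ => (k : ℝ) * |Literature.MathematicalPhysics.StatisticalMechanics.barlowCoupling Literature.MathematicalPhysics.StatisticalMechanics.lennardJones a h k|) ∧ ∃ (w : ℤ → ℤ) (p : ℕ), 0 < p ∧ (∀ i, w (i + p) = w i) ∧ Literature.MathematicalPhysics.StatisticalMechanics.IsHaggSeq w ∧ IsLeast (Set.range fun s : {s : ℤ → ℤ // Literature.MathematicalPhysics.StatisticalMechanics.IsHaggSeq s} => Literature.MathematicalPhysics.StatisticalMechanics.haggStackingEnergy (Literature.MathematicalPhysics.StatisticalMechanics.barlowCoupling Literature.MathematicalPhysics.StatisticalMechanics.lennardJones a h) s.1) (Literature.MathematicalPhysics.StatisticalMechanics.haggStackingEnergy (Literature.MathematicalPhysics.StatisticalMechanics.barlowCoupling Literature.MathematicalPhysics.StatisticalMechanics.lennardJones a h) w)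

/-- item stmt-AtomisticToContinuum-3062 · crux · rank 2 · open · by planner
why it might fail: Contains local optimality of close packing among ALL lattice+motif configurations (open, BlancLewin2015 §2.3); uniform spacings must beat layer-wise relaxed polytypes (gain ≲1e−8 vs hcp margin 3.6e−5 per layer, uncertified); the optimum might leave B.
sources: BlancLewin2015, FlatleyTheil2015, BeterminSamajTravenec2022, Stillinger2001, PartayOrtnerCsanyi2017, stmt-AtomisticToContinuum-3062
[crux] (R) ENERGETIC LAYERING/REDUCTION (card item (3), the genuinely 3-D content): for every
periodic configuration Q of ℝ³ there are (a,h) ∈ B and a periodic Hägg sequence s such that the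
uniform Barlow stacking barlowPeriodicConfiguration a h s has Lennard-Jones energy per particle ≤
that of Q. Intended mechanism (foreseen split): near-optimal periodic Q are twelve-coordinated
stacks of triangular layers (Flyspeck L12 cap + LJ bond counting, as in CrystalKissingRigidity K1/K2
but for PERIODIC Q, no N → ∞ defects), lateral offsets are forced into the deep holes by
AdjacentLayerHoleLocking, and layer-dependent spacings relax to a uniform h by convexity of h ↦
Φ_N(h) (the registry corrections are ≤ 7.3e−5 with dJ₂/dh ≈ 5e−4 against an O(10) stiffness:
non-uniform relaxation gains ≲ 1e−8 per layer). [deps: AdjacentLayerHoleLocking] [difficulty: XL] -/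
@[route_item "route-AtomisticToContinuum-MinMeanCycleStackingLock", crux]
def PeriodicReductionToBarlow : Prop :=
  ∀ Q : Literature.MathematicalPhysics.StatisticalMechanics.PeriodicConfiguration 3, ∃ a h : ℝ, 47 / 50 ≤ a ∧ a ≤ 1 ∧ 39 / 50 * a ≤ h ∧ h ≤ 17 / 20 * a ∧ ∃ (s : ℤ → ℤ) (p : ℕ) (ha : a ≠ 0) (hh : h ≠ 0) (hp : p ≠ 0) (hs : ∀ i, s (i + p) = s i), Literature.MathematicalPhysics.StatisticalMechanics.IsHaggSeq s ∧ (Literature.MathematicalPhysics.StatisticalMechanics.barlowPeriodicConfiguration s ha hh hp hs).energyPerParticle Literature.MathematicalPhysics.StatisticalMechanics.lennardJones ≤ Q.energyPerParticle Literature.MathematicalPhysics.StatisticalMechanics.lennardJones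

/-- item stmt-AtomisticToContinuum-12018 · crux · rank 3 · open · by planner
why it might fail: Only by bookkeeping: the tail constant 2Σ_{k>K}(k+|E|+1)|J_k|, windows poking beyond n, liminf junk values or a missing structural clause on E; the refuter paper proof on 3454 and brute force at K ≤ 3 (periods ≤ 10) found no violation.
sources: RadinSchulman1983, Teubner1990, HolsztynskiSlawny1978, FriedliVelenik2017, Contreras2015, GlodkowskiMiekisz2024
[crux] PEIERLS–KARP STABILITY LEMMA (card S1; pure 1-D lattice-gas theorem over HaggStacking.lean,
no LJ input; identical signature to retired item 3454, refuter-verified TRUE on paper there): for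
couplings J with Σ k|J_k| < ∞, a window length K = L+1, a nonempty set E of Hägg K-words with
out-degree ≤ 1, in-degree ≤ 1 and continuation inside E (E = disjoint simple cycles of the de Bruijn
graph), potentials u on (K−1)-words, value λ and gap g such that the slack Σ_{k=2}^{K}
J_k·1[x₀+…+x_{k−1} ≡ 0 (3)] − λ + u(prefix x) − u(suffix x) vanishes on E and is ≥ g on every other
Hägg K-word, and g ≥ 2Σ_{k>K}(k+|E|+1)|J_k|: SOME periodic sequence all of whose K-windows lie in E
minimises haggStackingEnergy J over all Hägg sequences. K = 2, E = {+−,−+}, u ≡ 0 is Hägg domination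
(0737) with a cruder constant. [difficulty: M] -/
@[route_item "route-AtomisticToContinuum-MinMeanCycleStackingLock", crux]
def PeierlsKarpStability : Prop :=
  ∀ (J : ℕ → ℝ) (L : ℕ) (E : Finset (Fin (L + 1) → ℤ)) (u : (Fin L → ℤ) → ℝ) (lam g : ℝ), Summable (fun k : ℕ => (k : ℝ) * |J k|) → E.Nonempty → (∀ x ∈ E, ∀ y ∈ E, (fun i : Fin L => x (Fin.castSucc i)) = (fun i : Fin L => y (Fin.castSucc i)) → x = y) → (∀ x ∈ E, ∀ y ∈ E, (fun i : Fin L => x (Fin.succ i)) = (fun i : Fin L => y (Fin.succ i)) → x = y) → (∀ x ∈ E, ∃ y ∈ E, (fun i : Fin L => y (Fin.castSucc i)) = (fun i : Fin L => x (Fin.succ i))) → (∀ x ∈ E, (∀ i, x i = 1 ∨ x i = -1) ∧ (∑ k ∈ Finset.Icc 2 (L + 1), if (∑ i : Fin (L + 1), if (i : ℕ) < k then x i else 0) % 3 = 0 then J k else 0) - lam + u (fun i : Fin L => x (Fin.castSucc i)) - u (fun i : Fin L => x (Fin.succ i)) = 0) → (∀ x : Fin (L + 1) → ℤ, (∀ i,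 x i = 1 ∨ x i = -1) → x ∉ E → g ≤ (∑ k ∈ Finset.Icc 2 (L + 1), if (∑ i : Fin (L + 1), if (i : ℕ) < k then x i else 0) % 3 = 0 then J k else 0) - lam + u (fun i : Fin L => x (Fin.castSucc i)) - u (fun i : Fin L => x (Fin.succ i))) → 2 * (∑' k : ℕ, if L + 1 < k then ((k : ℝ) + E.card + 1) * |J k| else 0) ≤ g → ∃ (w : ℤ → ℤ) (p : ℕ), 0 < p ∧ (∀ i, w (i + p) = w i) ∧ (∀ m : ℤ, (fun i : Fin (L + 1) => w (m + ((i : ℕ) : ℤ))) ∈ E) ∧ IsLeast (Set.range fun s : {s : ℤ → ℤ // Literature.MathematicalPhysics.StatisticalMechanics.IsHaggSeq s} => Literature.MathematicalPhysics.StatisticalMechanics.haggStackingEnergy J s.1) (Literature.MathematicalPhysics.StatisticalMechanics.haggStackingEnergy J w)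

/-- item stmt-AtomisticToContinuum-12019 · crux · rank 4 · open · by planner
why it might fail: Needs interval-certified 2-D lattice sums J_k(a,h) uniformly on B plus a tail bound (no such infrastructure in tree); fails if J₂ changes sign on B or no finite K locks (Hubbard-type selection); the K=2 witness rests on uncertified floats (ratio 47–98).
sources: PartayOrtnerCsanyi2017, LoachAckland2017, Stillinger2001, stmt-AtomisticToContinuum-3063, stmt-AtomisticToContinuum-3453, Literature.Barriers.AtomisticToContinuum.Hubbard1978_mostHomogeneous
[crux] CERTIFIED LOCKING CERTIFICATE for Lennard-Jones on the box (card S2–S3; identical signature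
to retired item 3453): there are a window length K = L+1 and a set E of Hägg K-words forming
node-disjoint simple cycles such that for every (a,h) ∈ B, with J = barlowCoupling lennardJones a h:
Σ k|J_k| < ∞ and there are node potentials u, a value λ and a gap g with slack = 0 on E, ≥ g on
every other Hägg K-word, and g ≥ 2Σ_{k>K}(k+|E|+1)|J_k|. Expected witness: L = 1, E = {(+,−),(−,+)},
u ≡ 0, λ = J₂ < 0, g = −J₂ ≈ 7e−5 against 2Σ_{k≥3}(k+3)|J_k| ∈ [3.8e−7, 3.0e−6] on B (float ratio
47–98); to be certified by interval arithmetic (direct layer sums with an r⁻⁶ tail bound, or the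
Poisson–Bessel form of PoissonBesselStacking) uniformly on B — one interval job shared with item
3063. [deps: PeierlsKarpStability] [difficulty: L] -/
@[route_item "route-AtomisticToContinuum-MinMeanCycleStackingLock", crux]
def LJLockingCertificate : Prop :=
  ∃ (L : ℕ) (E : Finset (Fin (L + 1) → ℤ)), E.Nonempty ∧ (∀ x ∈ E, ∀ y ∈ E, (fun i : Fin L => x (Fin.castSucc i)) = (fun i : Fin L => y (Fin.castSucc i)) → x = y) ∧ (∀ x ∈ E, ∀ y ∈ E, (fun i : Fin L => x (Fin.succ i)) = (fun i : Fin L => y (Fin.succ i)) → x = y) ∧ (∀ x ∈ E, ∃ y ∈ E, (fun i : Fin L => y (Fin.castSucc i)) = (fun i : Fin L => x (Fin.succ i))) ∧ ∀ a h : ℝ, 47 / 50 ≤ a → a ≤ 1 → 39 / 50 * a ≤ h → h ≤ 17 / 20 * a → let J : ℕ → ℝ := Literature.MathematicalPhysics.StatisticalMechanics.barlowCoupling Literature.MathematicalPhysics.StatisticalMechanics.lennardJones a h; Summable (fun k : ℕ => (k : ℝ) * |J k|) ∧ ∃ (u : (Fin L → ℤ) → ℝ) (lam g : ℝ), (∀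 x ∈ E, (∀ i, x i = 1 ∨ x i = -1) ∧ (∑ k ∈ Finset.Icc 2 (L + 1), if (∑ i : Fin (L + 1), if (i : ℕ) < k then x i else 0) % 3 = 0 then J k else 0) - lam + u (fun i : Fin L => x (Fin.castSucc i)) - u (fun i : Fin L => x (Fin.succ i)) = 0) ∧ (∀ x : Fin (L + 1) → ℤ, (∀ i, x i = 1 ∨ x i = -1) → x ∉ E → g ≤ (∑ k ∈ Finset.Icc 2 (L + 1), if (∑ i : Fin (L + 1), if (i : ℕ) < k then x i else 0) % 3 = 0 then J k else 0) - lam + u (fun i : Fin L => x (Fin.castSucc i)) - u (fun i : Fin L => x (Fin.succ i))) ∧ 2 * (∑' k : ℕ, if L + 1 < k then ((k : ℝ) + E.card + 1) * |J k| else 0) ≤ g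

/-- item stmt-AtomisticToContinuum-12020 · crux · rank 5 · open · by planner
why it might fail: Needs layering of finite LJ ground states (soft twelve-coordination + a local-Hales step whose 1%-tolerance form is refuted, negatives 4146; Böröczky–Szabó quasi-12-shells) plus O(1) fault planes; persistent icosahedral/polytetrahedral bulk order in LJ ground states refutes it.
sources: BlancLewin2015, FlatleyTheil2015, Hales2012, LucaFriesecke2016, BoroczkySzabo2016, PartayOrtnerCsanyi2017
[crux] X_pos, the POLYTYPE-AGNOSTIC HINGE (new; the base-point variant of 0751 suggested by refuter
g28-4, 2026-08-13): there is ONE periodic configuration P such that for every window radius R and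
tolerance ε, in every sequence of LJ ground states all but o(N) particles i admit a linear isometry
A and a base point p ∈ P.points with the particles of B_R(x_i) ε-matched both ways to x_i +
A((P.points − p) ∩ B_R). Unlike 0751 (pattern x_i + A(P.points), which silently forces 0 ∈ P.points
and a VERTEX-TRANSITIVE limit crystal — true for hcp/fcc, false for dhcp-type polytypes) it holds
for whichever Barlow polytype the certificate locks; 0751 implies it (p = 0). Its stacking half is
fed by this route's fault price (LockedPhaseDefectBound ⇒ ≤ (Δ + C)/(g − 2·tail) off-certificate
windows against the O(N^{2/3}) surface budget ⇒ O(1) fault planes); its layering half (soft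
twelve-coordination + a local Hales step) is the shared open physics of every
sphere-packing-heritage route. [difficulty: XL] -/
@[route_item "route-AtomisticToContinuum-MinMeanCycleStackingLock", crux]
def BulkDefectVanishBased : Prop :=
  ∃ P : Literature.MathematicalPhysics.StatisticalMechanics.PeriodicConfiguration 3, ∀ R ε : ℝ, 0 < R → 0 < ε → ∀ x : (N : ℕ) → (Fin N → EuclideanSpace ℝ (Fin 3)), (∀ N, Literature.MathematicalPhysics.StatisticalMechanics.IsGroundState Literature.MathematicalPhysics.StatisticalMechanics.lennardJones (x N)) → Filter.Tendsto (fun N : ℕ => (Nat.card {i : Fin N // ¬ ∃ A : EuclideanSpace ℝ (Fin 3) →ₗᵢ[ℝ] EuclideanSpace ℝ (Fin 3), ∃ p ∈ P.points, (∀ q ∈ P.points, dist q p ≤ R → ∃ j : Fin N, dist (x N j) (x N i + A (q - p)) ≤ ε) ∧ (∀ j : Fin N, dist (x N j) (x N i) ≤ R → ∃ q ∈ P.points, dist (x N j) (x N i + A (q - p)) ≤ ε)} : ℝ) / N) Filter.atTop (nhds 0)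

/-- item stmt-AtomisticToContinuum-0626 · support · rank 9 · closed · proved by Summit.AtomisticToContinuum.Crystallization.Theorems.crysEnergyLimit_proof @ de27d46e58f4 (prover) · by planner
sources: BlancLewin2015, stmt-AtomisticToContinuum-0626
Energetic crystallization: E(N)/N converges to the infimum over periodic (multi-lattice)
configurations of the LJ energy per particle in d = 3. Lower bound liminf ≥ ⨅ is the content ((a)
local optimality + (d) + surface term O(N^{2/3})); upper bound is filed separately. -/
@[route_item "route-AtomisticToContinuum-MinMeanCycleStackingLock", crux]
def CrysEnergyLimit : Prop :=
  Filter.Tendsto (fun N : ℕ => Literature.MathematicalPhysics.StatisticalMechanics.groundStateEnergy Literature.MathematicalPhysics.StatisticalMechanics.lennardJones 3 N / N) Filter.atTop (nhds (⨅ Q : Literature.MathematicalPhysics.StatisticalMechanics.PeriodicConfiguration 3, Q.energyPerParticle Literature.MathematicalPhysics.StatisticalMechanics.lennardJones))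

/-- `CrysEnergyLimit` holds: proved by `Summit.AtomisticToContinuum.Crystallization.Theorems.crysEnergyLimit_proof` @ de27d46e58f4. -/
theorem CrysEnergyLimit_holds : CrysEnergyLimit := _root_.Summit.AtomisticToContinuum.Crystallization.Theorems.crysEnergyLimit_proof

/-- item stmt-AtomisticToContinuum-12021 · support · rank 9 · closed · proved by Summit.AtomisticToContinuum.Crystallization.Theorems.certificateLocks_proof @ 0ea98118b10f (prover) · by planner
sources: RadinSchulman1983, stmt-AtomisticToContinuum-3455
[support] glue of the target: the stability lemma instantiated with the LJ certificate gives
LockedStackingOnBox (pure instantiation; E-words are Hägg words, so the E-periodic minimiser is a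
Hägg sequence). Identical signature shape to retired 3455, which a refuter PROVED as evidence
(CertEvidence on 3455) — re-prove against the new decls. [difficulty: provable-now] -/
@[route_item "route-AtomisticToContinuum-MinMeanCycleStackingLock", crux]
def CertificateLocks : Prop :=
  PeierlsKarpStability → LJLockingCertificate → LockedStackingOnBox

/-- item stmt-AtomisticToContinuum-12022 · support · rank 9 · closed · proved by Summit.AtomisticToContinuum.Crystallization.Theorems.haggEnergyPeriodic_proof @ 2dd0c69042b7 (prover) · by planner
sources: PartayOrtnerCsanyi2017, stmt-AtomisticToContinuum-3456
[support] for summable J and a p-periodic sequence s (p > 0) the stacking energy density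
haggStackingEnergy J s (a liminf of H_n/n) equals the per-period average haggEnergy p J s / p (local
energies are p-periodic in the base point, H_{qp+r} = q·H_p + O(p·Σ|J_k|); haggLocalEnergy_periodic,
liminf of a convergent sequence). Identical signature to retired 3456; useful to every stacking
route. [difficulty: provable-now] -/
@[route_item "route-AtomisticToContinuum-MinMeanCycleStackingLock", crux]
def HaggEnergyPeriodic : Prop :=
  ∀ (J : ℕ → ℝ) (s : ℤ → ℤ) (p : ℕ), Summable J → 0 < p → (∀ i, s (i + p) = s i) → Literature.MathematicalPhysics.StatisticalMechanics.haggStackingEnergy J s = Literature.MathematicalPhysics.StatisticalMechanics.haggEnergy p J s / p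

/-- item stmt-AtomisticToContinuum-12023 · support · rank 9 · closed · proved by Summit.AtomisticToContinuum.Crystallization.Theorems.lockedBoxMinimiser_proof @ a49b624a19a8 (prover) · by planner
sources: BlancLewin2015, BeterminSamajTravenec2022, stmt-AtomisticToContinuum-0627, stmt-AtomisticToContinuum-3457
[support] ANALYSIS GLUE to the attained periodic minimum (0627; = retired 3457 with the third
hypothesis written out): LockedStackingOnBox → PeriodicReductionToBarlow → [the statement of
BarlowEnergyIdentification, item 3065, INLINED verbatim — the gate renders rank-9 items in id-string
order, so this new item must not name a decl whose 4-digit id sorts after its own 5-digit one;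
`closes` feeds the item BarlowEnergyIdentification into this slot by definitional unfolding] →
HaggEnergyPeriodic → ∃ P periodic, IsLeast (range e_LJ) (e P). Proof: φ(a,h) := e₀(a,h) + min_s
haggStackingEnergy(J(a,h), s) is continuous on the compact box B (e₀ and (a,h) ↦ (J_k(a,h))_k ∈ ℓ¹
depend continuously on (a,h) by uniform convergence of the LJ layer sums on B; an infimum of an
equicontinuous affine family is continuous), so it is attained at some (a₀,h₀); P :=
barlowPeriodicConfiguration w_{a₀,h₀}; for any Q the reduction gives a box stacking s_Q at (a,h)
with e(Q) ≥ e(s_Q) = e₀(a,h) + H_p/p ≥ e₀(a,h) + haggStackingEnergy(s_Q) ≥ φ(a,h) ≥ φ(a₀,h₀) = e(P).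
[difficulty: M] -/
@[route_item "route-AtomisticToContinuum-MinMeanCycleStackingLock", crux]
def LockedBoxMinimiser : Prop :=
  LockedStackingOnBox → PeriodicReductionToBarlow → (∀ a h : ℝ, 0 < a → 0 < h → ∀ (s : ℤ → ℤ) (p : ℕ) (ha : a ≠ 0) (hh : h ≠ 0) (hp : p ≠ 0) (hs : ∀ i, s (i + p) = s i), Literature.MathematicalPhysics.StatisticalMechanics.IsHaggSeq s → (Literature.MathematicalPhysics.StatisticalMechanics.barlowPeriodicConfiguration s ha hh hp hs).energyPerParticle Literature.MathematicalPhysics.StatisticalMechanics.lennardJones = Literature.MathematicalPhysics.StatisticalMechanics.barlowBaseEnergy Literature.MathematicalPhysics.StatisticalMechanics.lennardJones a h + Literature.MathematicalPhysics.StatisticalMechanics.haggEnergy p (Literature.MathematicalPhysics.StatisticalMechanics.barlowCoupling Literature.MathematicalPhysics.StatisticalMechanics.lennardJones a h) s / p) → HaggEnergyPeriodic → ∃ P : Literature.MathematicalPhysics.StatisticalMechanics.PeriodicConfiguration 3, IsLeast (Set.range fun Q : Literature.MathematicalPhysics.StatisticalMechanics.PeriodicConfiguration 3 => Q.energyPerParticle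 Literature.MathematicalPhysics.StatisticalMechanics.lennardJones) (P.energyPerParticle Literature.MathematicalPhysics.StatisticalMechanics.lennardJones)

/-- item stmt-AtomisticToContinuum-12024 · support · rank 9 · closed · proved by Summit.AtomisticToContinuum.Crystallization.Theorems.lockedPhaseDefectBound_proof (prover) · by planner
sources: HolsztynskiSlawny1978, FriedliVelenik2017, stmt-AtomisticToContinuum-3458, stmt-AtomisticToContinuum-0759
[support] QUANTITATIVE LOCKING (the Peierls inequality behind the lemma, supplier of the per-fault
price that the stacking half of the hinge consumes; identical signature to retired 3458,
refuter-verified TRUE on paper with C = osc(u) + t₁ + |E|t₀/2): under the hypotheses of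
PeierlsKarpStability there are an E-periodic w and a constant C such that for every Hägg sequence s
and every n: (g − 2Σ_{k>K}(k+|E|+1)|J_k|)·#{m < n : the K-window of s at m is not in E} ≤ haggEnergy
n J s − n·haggStackingEnergy J w + C. [difficulty: M] -/
@[route_item "route-AtomisticToContinuum-MinMeanCycleStackingLock", crux]
def LockedPhaseDefectBound : Prop :=
  ∀ (J : ℕ → ℝ) (L : ℕ) (E : Finset (Fin (L + 1) → ℤ)) (u : (Fin L → ℤ) → ℝ) (lam g : ℝ), Summable (fun k : ℕ => (k : ℝ) * |J k|) → E.Nonempty → (∀ x ∈ E, ∀ y ∈ E, (fun i : Fin L => x (Fin.castSucc i)) = (fun i : Fin L => y (Fin.castSucc i)) → x = y) → (∀ x ∈ E, ∀ y ∈ E, (fun i : Fin L => x (Fin.succ i)) = (fun i : Fin L => y (Fin.succ i)) → x = y) → (∀ x ∈ E, ∃ y ∈ E, (fun i : Fin L => y (Fin.castSucc i)) = (fun i : Fin L => x (Fin.succ i))) → (∀ x ∈ E, (∀ i, x i = 1 ∨ x i = -1) ∧ (∑ k ∈ Finset.Icc 2 (L + 1), if (∑ i : Fin (L + 1), if (i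 : ℕ) < k then x i else 0) % 3 = 0 then J k else 0) - lam + u (fun i : Fin L => x (Fin.castSucc i)) - u (fun i : Fin L => x (Fin.succ i)) = 0) → (∀ x : Fin (L + 1) → ℤ, (∀ i, x i = 1 ∨ x i = -1) → x ∉ E → g ≤ (∑ k ∈ Finset.Icc 2 (L + 1), if (∑ i : Fin (L + 1), if (i : ℕ) < k then x i else 0) % 3 = 0 then J k else 0) - lam + u (fun i : Fin L => x (Fin.castSucc i)) - u (fun i : Fin L => x (Fin.succ i))) → 2 * (∑' k : ℕ, if L + 1 < k then ((k : ℝ) + E.card + 1) * |J k| else 0) ≤ g → ∃ (w : ℤ → ℤ) (p : ℕ) (C : ℝ), 0 < p ∧ (∀ i, w (i + p) = w i) ∧ (∀ m : ℤ, (fun i : Fin (L + 1) => w (m + ((i : ℕ) : ℤ))) ∈ E) ∧ ∀ (s : ℤ → ℤ) (n : ℕ), Literature.MathematicalPhysics.StatisticalMechanics.IsHaggSeq s → (g - 2 * (∑' k : ℕ, if L + 1 < k then ((k : ℝ) + E.card + 1) * |J k| else 0)) * (((Finset.range n).filter (fun m : ℕ => (fun i : Fin (L + 1) => s ((m : ℤ)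 + ((i : ℕ) : ℤ))) ∉ E)).card : ℝ) ≤ Literature.MathematicalPhysics.StatisticalMechanics.haggEnergy n J s - (n : ℝ) * Literature.MathematicalPhysics.StatisticalMechanics.haggStackingEnergy J w + C

/-- item stmt-AtomisticToContinuum-12025 · support · rank 9 · closed · proved by Summit.AtomisticToContinuum.Crystallization.Theorems.MinMeanCycleStackingLockBasedDefectVanishCrystallizes.basedDefectVanishCrystallizes_proof @ 182f2fa03f12 (prover) · by planner
sources: BlancLewin2015, Xue1997, stmt-AtomisticToContinuum-0752
[support] SOFT ASSEMBLY LEMMA for the based hinge (the analogue of 0752): BulkDefectVanishBased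
together with the uniform minimal distance of LJ ground states implies IsCrystallizing lennardJones
3 — pick R_k = k, ε_k = 1/k, indices N_k ↑, good particles i_k with isometries A_k and base points
p_k; reduce p_k modulo P.lattice to the finite motif (P.points − p depends only on p mod lattice)
and pass to a subsequence with constant motif point y; τ_k := −x_{i_k}; extract A_k → A in O(3);
minimal distance (given) + discreteness of P (forced by the ∀ε matching) make the ε-matching a local
bijection, so Σ_i f(x_i + τ_k) → Σ_{s ∈ A(P.points − y)} f(s) for f ∈ C_c; A(P − y) is again a
PeriodicConfiguration, multiplicity m ≡ 1. [difficulty: M] -/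
@[route_item "route-AtomisticToContinuum-MinMeanCycleStackingLock", crux]
def BasedDefectVanishCrystallizes : Prop :=
  BulkDefectVanishBased → Literature.MathematicalPhysics.StatisticalMechanics.LennardJonesMinimalDistance → Literature.MathematicalPhysics.StatisticalMechanics.IsCrystallizing Literature.MathematicalPhysics.StatisticalMechanics.lennardJones 3

/-- item stmt-AtomisticToContinuum-3065 · support · rank 9 · closed · proved by Summit.AtomisticToContinuum.Crystallization.Theorems.PricedHcpWindowsBarlowEnergy.stub_barlowEnergyIdentification @ bf3f020dee6e (prover) · by planner
sources: BlancLewin2015, PartayOrtnerCsanyi2017, stmt-AtomisticToContinuum-3065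
[support] the regrouping left open in BarlowStackingEnergy.lean ('Not proved here'): for a, h > 0
and a p-periodic Hägg sequence s, the energy per particle (Crystallization.lean, tsum over the point
set) of barlowPeriodicConfiguration a h s equals barlowBaseEnergy lennardJones a h + haggEnergy p
(barlowCoupling lennardJones a h) s / p (absolute summability of the LJ lattice sum,
PeriodicConfigurationSums.lean, + barlowSiteEnergy_average_eq_haggEnergy + motif card = p).
[difficulty: provable-now] -/
@[route_item "route-AtomisticToContinuum-MinMeanCycleStackingLock", crux]
def BarlowEnergyIdentification : Prop :=
  ∀ a h : ℝ, 0 < a → 0 < h → ∀ (s : ℤ → ℤ) (p : ℕ) (ha : a ≠ 0) (hh : h ≠ 0) (hp : p ≠ 0) (hs : ∀ i, s (i + p) = s i), Literature.MathematicalPhysics.StatisticalMechanics.IsHaggSeq s → (Literature.MathematicalPhysics.StatisticalMechanics.barlowPeriodicConfiguration s ha hh hp hs).energyPerParticle Literature.MathematicalPhysics.StatisticalMechanics.lennardJones = Literature.MathematicalPhysics.StatisticalMechanics.barlowBaseEnergy Literature.MathematicalPhysics.StatisticalMechanics.lennardJones a h + Literature.MathematicalPhysics.StatisticalMechanics.haggEnergy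 p (Literature.MathematicalPhysics.StatisticalMechanics.barlowCoupling Literature.MathematicalPhysics.StatisticalMechanics.lennardJones a h) s / p

/-- item stmt-AtomisticToContinuum-12026 · assembly · rank 1 · closed · proved by Summit.AtomisticToContinuum.Crystallization.Theorems.minMeanCycleStackingLock_assembly_proof (prover) · by planner
sources: BlancLewin2015
[assembly] LockedBoxMinimiser → LockedStackingOnBox → PeriodicReductionToBarlow →
BarlowEnergyIdentification → HaggEnergyPeriodic → CrysEnergyLimit → BulkDefectVanishBased →
BasedDefectVanishCrystallizes → LennardJonesMinimalDistance → Crystallization (the sub-problem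
decl). -/
@[route_item "route-AtomisticToContinuum-MinMeanCycleStackingLock", crux]
def Assembly : Prop :=
  LockedBoxMinimiser → LockedStackingOnBox → PeriodicReductionToBarlow → BarlowEnergyIdentification → HaggEnergyPeriodic → CrysEnergyLimit → BulkDefectVanishBased → BasedDefectVanishCrystallizes → Literature.MathematicalPhysics.StatisticalMechanics.LennardJonesMinimalDistance → _root_.Crystallization

/-! D-0027 §2.1 — DECIDING THEOREM (planner-authored via `route open/edit --closes-file`; by planner-plancard-AtomisticToContinuum-Crystal-717b9dc8-g2-0 2026-08-15T18:47:51Z):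
its hypotheses are this route's items and its conclusion the sub-problem Statement (glue_lint), and it elaborates with this file. -/

@[closes "route-AtomisticToContinuum-MinMeanCycleStackingLock"] theorem closes : LockedStackingOnBox → PeriodicReductionToBarlow → PeierlsKarpStability → LJLockingCertificate →
    BulkDefectVanishBased → CertificateLocks → BarlowEnergyIdentification → HaggEnergyPeriodic → CrysEnergyLimit →
    LockedBoxMinimiser → LockedPhaseDefectBound → BasedDefectVanishCrystallizes → Assembly →
    _root_.Crystallization := by
  intro h_LockedStackingOnBox h_PeriodicReductionToBarlow h_PeierlsKarpStability h_LJLockingCertificate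
    h_BulkDefectVanishBased h_CertificateLocks h_BarlowEnergyIdentification h_HaggEnergyPeriodic h_CrysEnergyLimit
    h_LockedBoxMinimiser h_LockedPhaseDefectBound h_BasedDefectVanishCrystallizes h_Assembly
  -- energetic half X_lock ∧ X_red: the stability lemma instantiated with the LJ certificate is the target
  -- (CertificateLocks; the target hypothesis itself, LockedPhaseDefectBound and Assembly are carried, not used),
  -- and LockedBoxMinimiser turns target + reduction + layer bookkeeping into an attained periodic minimum P
  have hX : LockedStackingOnBox := h_CertificateLocks h_PeierlsKarpStability h_LJLockingCertificate
  obtain ⟨P, hP⟩ :=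
    h_LockedBoxMinimiser hX h_PeriodicReductionToBarlow h_BarlowEnergyIdentification h_HaggEnergyPeriodic
  -- the periodic minimum is attained at P, so ⨅_Q e(Q) = e(P) (IsLeast.csInf_eq)
  have hinf : (⨅ Q : Literature.MathematicalPhysics.StatisticalMechanics.PeriodicConfiguration 3,
      Q.energyPerParticle Literature.MathematicalPhysics.StatisticalMechanics.lennardJones) =
      P.energyPerParticle Literature.MathematicalPhysics.StatisticalMechanics.lennardJones :=
    hP.csInf_eq
  -- CrysEnergyLimit: E(N)/N → ⨅_Q e(Q), rewritten to e(P)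
  have hlim : Filter.Tendsto
      (fun N : ℕ => Literature.MathematicalPhysics.StatisticalMechanics.groundStateEnergy
        Literature.MathematicalPhysics.StatisticalMechanics.lennardJones 3 N / N) Filter.atTop
      (nhds (P.energyPerParticle Literature.MathematicalPhysics.StatisticalMechanics.lennardJones)) := by
    have h0 : CrysEnergyLimit := h_CrysEnergyLimit
    unfold CrysEnergyLimit at h0
    rw [hinf] at h0
    exact h0
  -- positional half X_pos: the based hinge + its soft assembly lemma, with the PROVED Literature theorem
  -- LennardJonesMinimalDistance_holds discharged inside the proof (no extra hypothesis)
  have hpos : Literature.MathematicalPhysics.StatisticalMechanics.IsCrystallizing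
      Literature.MathematicalPhysics.StatisticalMechanics.lennardJones 3 :=
    h_BasedDefectVanishCrystallizes h_BulkDefectVanishBased
      Literature.MathematicalPhysics.StatisticalMechanics.LennardJonesMinimalDistance_holds
  -- Crystallization = HasPeriodicGroundStateEnergy lennardJones 3 ∧ IsCrystallizing lennardJones 3
  exact ⟨⟨P, hP, hlim⟩, hpos⟩

end Summit.AtomisticToContinuum.Crystallization.Theses.MinMeanCycleStackingLock
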